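import Mathlib
import HarnessLib
import HarnessLib.Audit
import Summits.CriticalPhenomena.Statement
import HarnessLib.Audit.Status.Attr

/-!
Route: PerfectScreening

DORMANT since 2026-08-26T10:17:18Z (reconciler: no traction for 8.3 d (last activity item-evidence-added at 2026-08-18T01:26:49Z); parked, not closed — `ledger route dormant route-CriticalPhenomena-PerfectScreening --off` to reactivate) — unstaffed, not closed; items shared with open routes are served there. `ledger route dormant <id> --off` reactivates.

PERFECT SCREENING — dichotomy form (rev 4; idea card
CriticalPhenomena/Ising3DConformalLimit/perfect-screening-subharmonic).
It suffices to show X_PS' = SubH ∧ CoulombU4 ∧ GaussNS ∧ MoebLim, where (G := ⟨σ₀σ_x⟩⁺_{β_c(3)} =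
criticalTwoPoint 3, G₀ := Green function of the graph Laplacian of ℤ³):
 SubH [crux r2, tier-deciding] G is LATTICE-SUBHARMONIC OFF THE ORIGIN, 6·G(x) ≤ Σ_i
(G(x+e_i)+G(x−e_i)) for x ≠ 0: the screening charge −ΔG is a point charge μ(0) = 6(1−G(e₁)) at 0
minus a Lévy (nonnegative, finite) cloud ν. With the classical Green asymptotics this gives the
SCREENING DICHOTOMY (support ScreeningDichotomy, lattice potential theory + Messager–Miracle-Solé):
EITHER the two-sided Coulomb law c/‖x‖ ≤ G ≤ C/‖x‖ (residue Z := μ(0) − ν(ℤ³∖0) > 0) OR perfect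
screening ‖x‖·G(x) → 0 (Z = 0) — no intermediate oscillation of ‖x‖G(x).
 CoulombU4 [crux r3] COULOMB ⇒ INTERACTING: if c/‖x‖ ≤ G then every non-degenerate pointwise scaling
limit of criticalCorr 3 has U₄ ≢ 0 — second-moment intersection of two independent sourced random
currents (Aizenman 1982; ADC 2021 Lemma 4.4 + Prop. A.3): under two-sided 1/r bounds E N ≍ R and E
N² ≍ R² ('2 + 2 > 3'), the two-point inputs of card top-heavy-bubble-nontriviality being discharged
by the hypothesis.
 GaussNS [crux r4] SCREENED ⇒ NOT GAUSSIAN: a non-degenerate Möbius-covariant pointwise scaling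
limit with U₄ ≡ 0 is incompatible with ‖x‖G → 0 (a free limit of the nearest-neighbour model is
canonically normalised; the weak form of rev-3 GaussianLimitIsCoulomb).
 MoebLim [crux r5, imported complement] existence of a non-degenerate Möbius-covariant pointwise
scaling limit (ρ, Δ, S) of criticalCorr 3 (= the conjunct minus clause (iii)).
Deciding theorem (glue, 6 lines): take (ρ, Δ, S) from MoebLim; if U₄ ≡ 0, the Coulomb branch of the
dichotomy contradicts CoulombU4 and the screened branch contradicts GaussNS; hence HasNontrivialU4
S, which is Ising3DConformalLimit. Antecedents: GreenAsymptotics (known, Lawler–Limic Thm 4.3.1) and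
ScreeningDichotomy (provable now).
Lean: SubharmonicOffOrigin ∧ CoulombImpliesNontrivial ∧ GaussianLimitNotScreened ∧
MoebiusLimitExists (decls of this file).
Rev-4 AUDIT NOTE (promote pass): the rev-3 deciding theorem did not use SubH — NonSaturation already
contradicts the strong conclusion ∀x≠0, c/‖x‖ ≤ G of GaussianLimitIsCoulomb (planner folder
Sketch.lean `closes_rev3_without_SubH`, 3 hypotheses, rc 0). Rev 4 makes SubH load-bearing through
its dichotomy and keeps NonSaturation, GaussianLimitIsCoulomb, ScreeningUpgrade as SUPPORT (the
SubH-free alternative closure).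

Rationale: WHY THIS LINE. Imported area: lattice POTENTIAL THEORY / electrostatics of ℤ³ (Riesz decomposition,
maximum principle, Gauss flux — LawlerLimic2010 ch. 4/6; Lévy–Khintchine on the torus —
BergChristensenRessel1984 Ch. 4 Prop. 3.15) applied to the critical two-point function G, where the
native tools (GKS, Simon1980/Lieb1980, MessagerMiracleSoleJSP1977/Hegerfeldt1977, the infrared bound
FrohlichSimonSpencer1976/FrohlichIsraelLiebSimon1978, AizenmanDuminilCopinAnnals2021 §5,
DuminilcopinPanis2025) give only the window c|x|⁻² ≤ G ≤ C|x|⁻¹. One sign conjecture, SubH (r2),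
makes the Gauss flux monotone and converts that window into a clean CASE SPLIT — Coulomb (Z > 0, G ≍
1/|x| two-sided) or perfectly screened (Z = 0, ‖x‖G → 0) — and each branch meets an engine it
maximally favours: (Coulomb) the second-moment intersection of independent sourced random currents,
whose only two-point input (top-heaviness of the bubble, doubling) is TRIVIAL under two-sided 1/r
bounds, so clause (iii) follows there from SingleDouble + a sourced tree bound (r3; AizenmanCMP1982,
ADC21 Lemma 4.4/Prop. A.3, tree fact ursellFour_eq_doubleCurrent, card
top-heavy-bubble-nontriviality); (screened) Gaussian rigidity in its WEAKEST useful form, 'a free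
limit of the n.n. model cannot be perfectly screened' (r4; Newman1975 + Markov inheritance +
Pitt1971/Kotani1973, plus amplitude). This is the rigorous skeleton of the physics lore 'η = 0 would
make σ free by unitarity, but 3D currents intersect': the route needs NO η > 0 input (rev-3
NonSaturation is now support) — the dichotomy replaces it. WHAT REV 4 FIXED: in rev 3 the deciding
theorem closed from NonSaturation + GaussianLimitIsCoulomb + MoebiusLimitExists alone (Lean proof
closes_rev3_without_SubH in the planner folder), i.e. SubH and the whole potential theory were idle;
now SubH is load-bearing (dichotomy antecedent) and the Gaussian crux is strictly weaker. ATTACK ON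
r2 (the tier-deciding crux). Two no-go observations fix the shape of any proof: (A) TREE NO-GO — on
the 6-regular tree with free boundary G = t^{dist} and ΔG(x) = t^{n−1}(1−t)(1−5t): exactly HARMONIC
at the Bethe critical point t = 1/5 and SUPERharmonic for t > 1/5; since tanh β_c(ℤ³) = 0.2181 >
1/5, no inequality valid for all graphs of maximal degree 6 at β = β_c(ℤ³) can give SubH — a proof
must use ℤ³ geometry (reflection positivity, loops, or criticality of β_c itself); (B) EXACT BALANCE
— D(x) := ΔG(x) = o(G(x)) (≡ 0 on the critical tree), so lossy inequalities (GKS, Newman's Gaussian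
bounds, Simon–Lieb, whose constant misses by 6 tanh β_c = 1.31, or the exact DLR multilinear form
D(x) = ⟨σ₀k(h_x)⟩, k = −0.0856e₁ + 0.0712e₃ − 0.0211e₅ in the elementary symmetric polynomials of
the six neighbour spins at β_c) cannot decide the sign; only IDENTITY-level representations with a
manifest sign can. The one such representation we have is the REFLECTION-POSITIVITY SPECTRAL
CALCULUS (first lemma filed as support MixedSpectralRepresentation = ADC21 Prop. 5.3/A.6 + Bochner,
known): G(n,x⊥) = ∫ λ^{|n|}cos(k·x⊥)dρ(λ,k), ρ ≥ 0 on [0,1]×𝕋², under which the lattice Laplacian is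
the signed weight w(λ,k) = (1−λ)² − λk̂²: ΔG(n,x⊥) = ∫λ^{n−1} w e^{ik·x⊥}dρ. So SubH on the nine
mirror lines (3 axes; 6 face diagonals via the diagonal transfer matrix, ADC21 §5.3) follows from
the LATTICE SPECTRAL CONDITION LSC 'no spectral weight of the spin field below the free lattice
dispersion ω₀(k) = arccosh(1 + k̂²/2)' — a hard spectral edge lying strictly INSIDE the continuum
light cone (ω₀(k) = |k| − |k|³/24 …, so emergent Lorentz invariance E ≥ |k| leaves an O(k³)
cushion). CALIBRATION (d = 2, exact): at K_c the Onsager/Schultz–Mattis–Lieb one-fermion dispersion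
cosh γ_q = cosh²2K_c − sinh²2K_c cos q = 2 − cos q COINCIDES with the free massless lattice
dispersion; γ is concave hence subadditive, so every odd multi-fermion state obeys Σγ(q_i) ≥ γ(Σq_i)
= ω₀: LSC holds, the one-fermion shell sits ON the curve (w = 0) and the 3,5,…-fermion continuum
strictly inside (w > 0), whence ΔG(n,0) > 0 for all n ≥ 1 — strict axial subharmonicity of the
critical 2D two-point function is a THEOREM of the mechanism (SchultzMattisLieb1964, Onsager1944).
Monday morning: (1) prove MixedSpectralRepresentation from the tube transfer matrix (tree:
TorusTransferSpectral, TorusTwoPointLimit; ADC21 App. Prop. 8.6 moment criterion); (2) prove the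
identity and 'LSC ⇒ axial SubH' (measure theory); (3) test LSC at β_c(3) by Lanczos on the
2^16/2^25-dimensional transfer matrices of 4×4×∞ and 5×5×∞ tubes (lowest Z₂-odd level E₁(k) − E₀ vs
ω₀(k) at k ∈ (2π/L)ℤ², the intermediate-k danger zone) and by MC effective energies of layer
correlations; (4) off the mirror lines the phase e^{ik·x⊥} must be controlled: for ‖x‖∞ = n the
relevant weight sits at 1−λ ≲ 1/n where LSC forces |k| ≲ 1/n, so |k·x⊥| ≲ 1 and cos > 0 on the
dominant region — the spectral scaling needed to bound the rest is the 'NOT DECOMPOSED' part.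
Equivalent global reformulation (for refuters/disprovers): SubH ⇔ ψ(p) := p̂²Ĝ(p) is a bounded
NEGATIVE-DEFINITE function on 𝕋³ ⇔ ψ = Z + Σ_{x≠0}ν(x)(1 − cos p·x), ν ≥ 0 (BCR84 Ch. 4 Prop. 3.15)
⇔ e^{−tψ} positive definite ∀t > 0 (Schoenberg; BCR84 Ch. 3 Thm. 2.2) ⇔ convolution by ΔG generates
a sub-Markov jump semigroup on ℤ³ (rates ΔG(x) ≥ 0, killing Z); the tempting sufficient condition
'self-energy 1/Ĝ − p̂²/μ(0) positive definite' is FALSE whenever η > 0 (|p|^{2−η} is negative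
definite), so do not file it. PRIOR PROGRAMME: docs/m5/inspiration not read. Dictionary: charge μ =
(−Δ)G, potential G₀∗μ, flux Q(R) ↓ Z = wave-function renormalisation, Lévy measure ν = screening
cloud, LSC = lattice light cone.
RANKED CRUXES. r2 SubharmonicOffOrigin (tier-deciding; new conjecture; cheapest to kill;
load-bearing as the antecedent of ScreeningDichotomy; attack = RP spectral calculus above; pre-filed
repair EventuallySubharmonic + ScreeningDichotomyEventual re-certify the deciding theorem if SubH
dies at |x| ≤ R₀ only). r3 CoulombImpliesNontrivial (conditional non-triviality: Coulomb ⇒ U₄ ≢ 0;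
engine in print for d = 4 upper bounds, run here as a lower bound where the hypothesis makes E N ≍
R, E N² ≍ R²; residual = SingleDouble + sourced tree bound + infinite-volume sourced currents;
d-specific by the count R^{4−d}). r4 GaussianLimitNotScreened (Gaussian Möbius limit ⇒ ¬(‖x‖G → 0);
strictly weaker than rev-3 GaussianLimitIsCoulomb and than 'inf of the amplitude > 0'; Δ = 1/2 half
shared with GaussianLimitIsFree of route AnomalousForcesInteraction, amplitude half new; finite
range essential — false for RP long-range α < 3/2). r5 MoebiusLimitExists (imported complement,
conjunct minus (iii); not attacked here). SUPPORT: GreenAsymptotics (known: LawlerLimic2010 Thm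
4.3.1 / LiuSlade named fact at d = 3); ScreeningDichotomy (LOAD-BEARING glue, provable now, 1–3
kLoC: Riesz decomposition G = μ(0)G₀ − G₀∗ν by the maximum principle at infinity, box sums for ν(ℤ³)
≤ μ(0), shell averages → c₀Z, MMS for the Coulomb branch, truncation of G₀∗ν for the screened
branch); MixedSpectralRepresentation (first lemma of the r2 attack, known); EventuallySubharmonic +
ScreeningDichotomyEventual (pre-filed repair of r2: finite exceptional set handled by a finitely
supported signed charge μ₀); NonSaturation + GaussianLimitIsCoulomb + ScreeningUpgrade (rev-3 chain
= the SubH-free alternative closure: NonSaturation ∧ GaussianLimitIsCoulomb ∧ MoebiusLimitExists ⇒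
conjunct in 20 lines; kept, not staffed); ScreeningInfraredBound (dividend: G ≤ 6(1−G(e₁))G₀,
predicts ⟨σ₀σ_{e₁}⟩_{β_c} ≤ 0.3405 vs 0.3302 measured); Assembly (rev-3 chain as one implication,
pure logic, 2 candidate proofs attached).
KILL CRITERIA. (a) r2 by data: the β_c Swendsen–Wang table of D(x) = ΣG(x±e_i) − 6G(x), |x|∞ ≤ 5, L
≤ 96 (evidence main.py on item 1341; jobs j000473/j000474 of refuter 1d6e7850, unreported at rev 4):
a D(x) < −5σ stable at the two largest L ⇒ r2 refuted-with-evidence ⇒ REPAIR by swapping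
(SubharmonicOffOrigin, ScreeningDichotomy) → (EventuallySubharmonic, ScreeningDichotomyEventual) in
the deciding theorem (certified in the planner folder, closes3) — the route then survives iff
worm-MC violations do NOT persist or grow relative to 0.0093/|x|³ at |x| ∈ [20,40]; if they do,
close the route refuted:r2 (the dichotomy itself is then in doubt). (b) r2's attack by spectrum: LSC
false at β_c(3) on 4×4×∞/5×5×∞ tubes or in MC effective energies (an odd level with E₁(k) − E₀ <
ω₀(k)) ⇒ the RP-spectral line for r2 is dead (r2 itself not refuted); record as a Disproof note. (c)
r3 by the card's fastest refutation: worm-algorithm ratio P^{xz}[u ∈ C_n(x)]/K(u) → 0 as R grows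
(SingleDouble false) ⇒ r3's engine dead; the Coulomb branch then reverts to the support
NonSaturation ('the Coulomb branch does not occur' = weak η > 0, no engine) and the route should be
re-tiered DOWN or merged with AnomalousForcesInteraction. (d) r4 by theory: a proof that Markov
inheritance + Pitt–Kotani cannot see the lattice amplitude (a Gaussian n.n.-compatible limit family
with ℓ → 0) ⇒ r4 needs a new idea; if moreover the strong form is shown necessary, rev 4 = rev 3 and
the route is dominated by the U₄-routes (close superseded). (e) structural: a refuter's novelty
audit grading the dichotomy-as-case-split 'known' with a printed source ⇒ re-grade, no close.
NOT DECOMPOSED YET. (i) r3 into SingleDouble / SourcedTreeBound / infinite-volume sourced currents +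
limit passage of U₄/(S₂S₂) (glued split once r2 is settled; decl texts in card
top-heavy-bubble-nontriviality). (ii) r4 into Newman-Gaussianity of the limit / Markov inheritance /
amplitude rigidity at Δ = 1/2 (the last has no known handle; the first two are shared with route
AnomalousForcesInteraction and MarkovRigidity). (iii) r2's spectral line beyond the mirror lines:
LSC as a typed statement (needs the joint (λ,k) measure, i.e. Bochner on ℤ² — not in Mathlib; the
filed first lemma is the quadratic-form version that avoids it), the diagonal transfer matrix, and
the phase control off the lines. (iv) The tail dictionary 'η = tail exponent of ν', the sum rule
Σ_{x≠0}ΔG(x) = 6(1−G(e₁)) ⇔ Z = 0, and the lattice Poisson identity for latticeGreen (provers attach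
with --supports). No Target item: X_PS' is the conjunction of the four cruxes.
CHEAPEST FALSIFIER. The queued SubH Monte-Carlo sign table (kill (a); ≈ 1–5 h on 4–6 cores, already
written, validated and queued twice) — refuters should READ ITS VERDICT BLOCK FIRST; next cheapest:
LSC on a 4×4×∞ tube by Lanczos (minutes) and the x = 0 consequence ⟨σ₀σ_{e₁}⟩_{β_c(3)} ≤ 0.3405 of
ScreeningInfraredBound (holds: 0.3302).
NUMBERS. μ(0) = 6(1 − 0.3302022) = 4.0188; G₀(0) = 0.252731 ⇒ 1 − 1/(6G₀(0)) = 0.34054; tanh β_c(3)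
= 0.218095, (1−t)(1−5t) = −0.0707 on the tree; DLR coefficients at β_c: k(h) = (−0.4983, −0.2583,
+0.7846) at h = 2,4,6, c₁ = −0.08563, c₃ = +0.07123, c₅ = −0.02105; tanh(βh) = 0.18094e₁ − 0.01187e₃
+ 0.00351e₅ (6a₁ = 1.0856 > 1: the linear channel alone is SUPERharmonic by 8.6 %, the cubic
(loop-sensitive) channel must win); predicted SubH margin Aη(1+η)|x|^{−3−η} ≈ 0.0093/|x|³, flip
radius (43|B|)^{1.2} for a negative correction amplitude B; ω₀(k) vs |k| on the axis: 0.1993/0.2,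
0.4899/0.5, 0.9255/1.0, 1.5295/2.0, 1.7592/3.0; 2D: cosh γ_q − (2 − cos q) ≡ 0 (checked numerically
at q = 0.3, 1, 2, 3).
SOURCES. Held and page-checked this pass: AizenmanDuminilCopinAnnals2021 = arXiv:1912.07973 (Prop.
5.3 p. 17; App. Prop. 8.6 pp. 32–33, all β, moment criterion; Lemma 4.4 p. 11; eq. (3.11));
GlimmJaffe1987 §6.1 Remark 'Transfer matrix of statistical physics' pp. 89–90 (0 ≤ K ≤ I, unitary
U(x)); BergChristensenRessel1984 Ch. 3 Thm. 2.2 p. 75 (Schoenberg), Ch. 4 Thm. 2.8 p. 96 (bounded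
p.d. functions on *-semigroups = mixtures of characters), Prop. 3.15 p. 105, Thm. 3.19 p. 108
(Lévy–Khinchin); Lawler1991 Thm 1.5.4; tree UrsellFourCurrents.lean, TwoPointLogConvex.lean,
LatticeLaplacianZd.lean, LocalSimonLieb.lean. Cited from earlier seats' page checks:
DuminilcopinPanis2025 (arXiv:2404.05700 Thm 1.3–1.5), Panis2023Triviality (arXiv:2309.05797),
Simon1980, Lieb1980, MessagerMiracleSoleJSP1977, Hegerfeldt1977, FrohlichSimonSpencer1976,
LawlerLimic2010 Thm 4.3.1, Newman1975, Pitt1971, Kotani1973, Rozanov1982. Standard, not re-read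
(remote search rate-limited this session): SchultzMattisLieb1964 (doi:10.1103/RevModPhys.36.856),
Onsager1944, AizenmanCMP1982 (doi:10.1007/BF01205659, acq-00013), arXiv:1603.03042
(Schuler–Whitsitt–Henry–Sachdev–Läuchli, 3D Ising torus spectra: lowest odd levels at the smallest
momenta lie well above the light cone).

Novelty: SUMMARY (rev 5). Nearest prior art FOUND: local Simon–Lieb G(x) ≤ tanh β·Σ_{y∼x}G(y) (Simon1980,
Lieb1980; tree criticalTwoPoint_le_tanh_mul_sum_nbrs) — misses SubH's 1/6 by 2d·tanh β_c ≈ 1.31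
(exact multilinear linear channel: 6a₁ = 1.086); Gaussian/random-walk bounds Krinsky–Emery 1974,
Morita 1975, Jędrzejewski 1978 (β < 1/2d); MessagerMiracleSoleJSP1977/Hegerfeldt1977 (first
differences); the spectral representation AizenmanDuminilCopinAnnals2021 Prop 5.3/A.6 +
GlimmJaffe1987 §6.1 (used there for log-convexity / sliding-scale IR bounds, never for a sign of
ΔG); the second-moment intersection engine ADC21 Lemma 4.4 + Prop A.3 / AizenmanCMP1982 and its d =
3 re-aiming in card top-heavy-bubble-nontriviality (graded variant); Newman1975/Pitt1971/Kotani1973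
rigidity (route AnomalousForcesInteraction). DELTA (rev 5): (1) SubH + potential theory as a CASE
SPLIT Coulomb-or-screened that feeds each branch the engine it favours — the Coulomb hypothesis
DISCHARGES the two-point inputs (top-heavy bubble, doubling) of the intersection engine, and the
Gaussian crux is weakened to 'not perfectly screened'; no η > 0 input remains; (2) the RP-spectral
ATTACK on SubH: ΔG(n,x⊥) = ∫λ^{n−1}[(1−λ)² − λk̂²]e^{ik·x⊥}dρ, axial SubH ⇐ lattice spectral
condition E ≥ ω₀(k) = arccosh(1+k̂²/2), with the exact 2D CALIBRATION cosh γ_q(Onsager, K_c) = 2 −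
cos q ≡ free lattice dispersion ⇒ strict axial subharmonicity of critical 2D Ising; (3) SubH ⇔ p̂²Ĝ
negative definite on 𝕋³ (Lévy–Khintchine, BergChris  [refs: 10.1016/0375-9601(74, 10.1016/0375-9601(75, 10.1016/0034-4877(78, 10.1007/bfb0061490, 1912.07973, 2404.05700, doi:10.1016/0375-9601, doi:10.1016/0034-4877, doi:10.1007/bfb0061490, Simon1980, Lieb1980, MessagerMiracleSoleJSP1977, Hegerfeldt1977, AizenmanDuminilCopinAnnals2021, GlimmJaffe1987, AizenmanCMP1982, Newman1975, Pitt1971, Kotani1973, BergChristensenRessel1984, FrohlichSimonSpencer1976, Dum]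

Barriers (technique_class: lattice-potential-theory, reflection-positivity, currents): - technique_class: lattice-potential-theory, correlation-inequality, reflection-positivity,
random-currents
- SUMMARY (rev 5; all 9 catalogued barriers, one line each below): the two triviality barriers are
EVADED by isolating the non-uniform input in one crux each — IsingTrivialityFromDimensionFour
(d-uniform arguments): the d-specific input is crux r3 CoulombImpliesNontrivial, whose engine counts
E N ≍ R^{4−d} common vertices of two sourced currents under two-sided |x|^{2−d} bounds — divergent
only for d < 4; for d ≥ 5 the hypothesis HOLDS (DuminilCopinPanis2025 Thm 1.4 + FSS/MMS) and the
conclusion FAILS (Gaussian limits), so no d-uniform version exists; LongRangeTrivialityOnZ3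
(interaction-uniform arguments on ℤ³): the finite-range input is crux r4 GaussianLimitNotScreened,
FALSE for reflection-positive |x|^{-3-α} models with α < 3/2 (Gaussian limits with G ≍ |x|^{-(3−α)},
i.e. screened: Panis2023Triviality) — its engine is the n.n. Markov/DLR structure; SubH is a
statement about the nearest-neighbour graph Laplacian. NOT MET: LaceExpansionIsingAboveFour (no
expansion; the bubble is a resource bounded BELOW in r3, never a convergence condition),
RigorousRGSmallParameter, PositionSpaceRGNonGibbsian (no RG map, no small parameter).
GaussianDominationRoute (token reflection-positivity): RP enters ONLY as the transfer-matrix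
spectral representation of G (ADC21 Prop 5.3; GlimmJaffe1987 §6.1) in the attack on r2 — never as
'IR bound ⇒ continuity/LRO criterion'; the IR bound is

Novelty grade: new-mechanism — ROUTE REVIEW (refuter-rreview-…-80a57a10-0, 2026-08-15). Novelty kept at the card audit's grade (new-mechanism: x-space lattice potential theory / sign of the graph Laplacian of the critical two-point function; the auditor READ Lieb1980 and ADC2021 §5); my session had no working remote search, local (refuter refuter-rreview-route-HubbardSuperconduc-80a57a10-0, 2026-08-15T11:23:51Z; prior: Simon1980, Lieb1980, FrohlichSimonSpencer1976, arXiv:1912.07973 §5)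

History (route lifecycle, newest last):
- 2026-08-26T10:17:18Z · DORMANT — reconciler: no traction for 8.3 d (last activity item-evidence-added at 2026-08-18T01:26:49Z); parked, not closed — `ledger route dormant route-CriticalPhenomen (operator:999:4030721)

sub-problem: Ising3DConformalLimit · status: dormant · opened planner-plancard-CriticalPhenomena-Ising3DCon-81a81da8-0 2026-08-15T10:54:58Z · rev 6 · ledger route-CriticalPhenomena-PerfectScreening
GENERATED by the gate from the ledger (D-0016/17). Provers cite these decls: `theorem foo : Summit.CriticalPhenomena.Ising3DConformalLimit.Theses.PerfectScreening.<Decl> := …` in Summits/CriticalPhenomena/Ising3DConformalLimit/Theorems/<Name>.lean.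
-/

namespace Summit.CriticalPhenomena.Ising3DConformalLimit.Theses.PerfectScreening

open scoped BigOperators Topology Manifold Classical MeasureTheory ProbabilityTheory Matrix InnerProductSpace ComplexConjugate ContinuousMap
open Filter Set Function TopologicalSpace MeasureTheory

attribute [summit_statement] _root_.Ising3DConformalLimit

/-- item stmt-CriticalPhenomena-1341 · crux · rank 2 · open · by planner
why it might fail: Sign of ΔG is set by lattice corrections at EVERY scale: asymptotic margin Aη(1+η)|x|^{-3-η}≈0.0093/|x|³ vs B|x|^{-ω} (flips for |x|≲(43|B|)^{1.2} if B<0) and razor-thin short distance (e₁: ≈3%); graph-uniform inequalities provably fail (Bethe tree, t_c=1/5<0.218); MC table pending.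
sources: Simon1980, Lieb1980, Literature.Probability.LatticeModels.criticalTwoPoint_le_tanh_mul_sum_nbrs, Literature.Probability.LatticeModels.one_le_two_mul_mul_tanh_criticalBeta, AizenmanDuminilCopinAnnals2021 (arXiv:1912.07973 Prop. 5.3 p.17, App. Prop. 8.6 pp.32–33: spectral representation = first lemma of the attack, support MixedSpectralRepresentation), GlimmJaffe1987 (§6.1 pp. 89–90)
[crux] r2 = SubH (the card's conjecture): the critical two-point function G = ⟨σ₀σ_x⟩⁺_{β_c(3)}
(criticalTwoPoint 3) is lattice-subharmonic off the origin, 6·G(x) ≤ Σ_i (G(x+e_i)+G(x−e_i)) for x ≠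
0; i.e. the charge μ := (−Δ)G is a positive point charge 6(1−G(e₁)) at 0 screened by a nonpositive
cloud. Natural general form (not filed): every d, every β ≥ 0, tori included. Evidence: exact
transfer-matrix checks on 2D L×L tori (L ≤ 8; β = 0.2…0.5) and 3D 3×3×L_z tori (L_z ≤ 5; β = 0.12,
0.2217, 0.3), strict at every site (card, exp/subharm.py); d = 1: Δ t^{|x|} = t^{|x|−1}(1−t)² ≥ 0;
2D β_c exact short-distance values comply with ~1% margins (audit). DLR form: ⟨σ₀ k(h_x)⟩ ≥ 0 with
k(h) = h − 6 tanh(β h) odd but sign-changing on {2,4,6} at β_c, so FKG does not apply directly; an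
identity-level (random-current / switching) expression for Σ_{y∼x}(G(y)−G(x)) is the suggested way
in. Cheapest refutation: exact TM on 4×4×L_z, 5×5×L_z; worm MC at β_c, |x| ≤ 40, predicted ΔG/G ≈
−0.04/|x|²; also the x = 0 consequence ⟨σ₀σ_{e₁}⟩_{β_c(3)} ≤ 0.3405 (ScreeningInfraredBound). -/
@[route_item "route-CriticalPhenomena-PerfectScreening", crux]
def SubharmonicOffOrigin : Prop :=
  ∀ x : Literature.Probability.LatticeModels.Site 3, x ≠ 0 → 6 * Literature.Probability.LatticeModels.criticalTwoPoint 3 x ≤ ∑ i : Fin 3, (Literature.Probability.LatticeModels.criticalTwoPoint 3 (x + Pi.single i 1) + Literature.Probability.LatticeModels.criticalTwoPoint 3 (x - Pi.single i 1))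

/-- item stmt-CriticalPhenomena-13885 · crux · rank 3 · open · by planner
why it might fail: SingleDouble has no precedent: sourced single-current clusters may be parametrically thinner than double-current ones (backbone reached via sourceless loops), giving E N ≪ R; the sourced two-point tree bound and infinite-volume sourced currents at β_c are also unbuilt.
sources: AizenmanCMP1982 (doi:10.1007/BF01205659, §5: U₄ via intersecting currents; d=2 lower bound), AizenmanDuminilCopinAnnals2021 (arXiv:1912.07973 eq. (3.11), Lemma 4.4 p. 11, Prop. A.3), Literature.Probability.LatticeModels.ursellFour_eq_doubleCurrent, DuminilCopin2016 (arXiv:1607.06933 eq. (24)), idea card CriticalPhenomena/Ising3DConformalLimit/top-heavy-bubble-nontriviality (SingleDouble, SourcedTreeBound; refuter audit 2026-08-15)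
[crux] r3 = COULOMB ⇒ INTERACTING (the Coulomb branch of the screening dichotomy): if the critical
two-point function obeys a Coulomb LOWER bound c/‖x‖ ≤ G(x), x ≠ 0 (with the infrared bound: the
two-sided law G ≍ 1/|x|, η = 0, residue Z > 0), then every non-degenerate pointwise scaling limit
(ρ, S) of criticalCorr 3 has U₄ ≢ 0. Engine = card top-heavy-bubble-nontriviality with its crux (1)
DISCHARGED by the hypothesis: |U₄(x,y,z,t)| = 2⟨σxσy⟩⟨σzσt⟩·P^{xy}⊗P^{zt}[x ↔ z in n₁+n₂] ≥
2⟨σxσy⟩⟨σzσt⟩·P⊗P[C_{n₁}(x) ∩ C_{n₂}(z) ≠ ∅] (tree fact ursellFour_eq_doubleCurrent; Aizenman 1982;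
ADC 2021 (3.11)); Paley–Zygmund on N := #common vertices of the two INDEPENDENT sourced clusters in
the middle ball: E N ≥ c Σ_u K₁(u)K₂(u), K(u) = G(xu)G(uy)/G(xy), via SingleDouble (P^{xy}[u ∈
C_n(x)] ≥ c K(u)); E N² ≤ Σ_{u,v}T₁T₂ via the sourced tree bound T(u,v) ≲ [G(xu)G(uv)G(vy) +
perm]/G(xy) (ADC 2021 Lemma 4.4 + Prop. A.3 shape). Under c/r ≤ G ≤ C/r at mutual distances ≍ R: E N
≍ R³·R⁻² = R and E N² ≲ R⁻²·Σ_{u,v∈B_R}|u−v|⁻²·O(1) ≍ R² (no logarithm) — the '2 + 2 > 3' dimension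
count — so P[merge] ≥ c′ > 0 uniformly in R, −U₄ ≥ 2c′S₂S₂ on the lattice, and the
renormalisation-free ratio passes to any n -/
@[route_item "route-CriticalPhenomena-PerfectScreening", crux]
def CoulombImpliesNontrivial : Prop :=
  (∃ c : ℝ, 0 < c ∧ ∀ x : Literature.Probability.LatticeModels.Site 3, x ≠ 0 → c / ‖x‖ ≤ Literature.Probability.LatticeModels.criticalTwoPoint 3 x) → ∀ (ρ : ℝ → ℝ) (S : Literature.Probability.LatticeModels.CorrFamily 3), (∀ δ ∈ Set.Ioc (0:ℝ) 1, 0 < ρ δ) → Literature.Probability.LatticeModels.HasPointwiseScalingLimit (Literature.Probability.LatticeModels.criticalCorr 3) ρ S → Literature.Probability.LatticeModels.IsNondegenerateTwoPoint S → Literature.Probability.LatticeModels.HasNontrivialU4 S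

/-- item stmt-CriticalPhenomena-13886 · crux · rank 4 · open · by planner
why it might fail: At Δ=1/2 a slowly varying screening factor ℓ→0 is invisible to the continuum (Pitt–Kotani fix the covariance shape, not the lattice amplitude); no lattice-to-continuum amplitude rigidity is known and Markov inheritance by the limit is unproved; false for long-range RP models.
sources: Newman1975Gaussian, Pitt1971, Kotani1973 (Thm 2), Rozanov1982 (Ch. 3 §2.3), Panis2023Triviality (arXiv:2309.05797 Thm 1.2, Cor 1.11), Literature.Probability.LatticeModels.scalingDimension_mem_Icc_holds
[crux] r4 = SCREENED ⇒ NOT GAUSSIAN (weak form of rev-3 GaussianLimitIsCoulomb, which implies it: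
Sketch lemma gaussianLimitNotScreened_of_isCoulomb): if (ρ, Δ, S) is a non-degenerate,
Möbius-covariant pointwise scaling limit of criticalCorr 3 whose connected four-point function
vanishes on non-coincident configurations, then the lattice two-point function is NOT perfectly
screened, ¬(‖x‖G(x) → 0 along the cofinite filter). Content: a pointwise scaling limit with
dimension Δ makes G regularly varying, G(x) = ℓ(|x|)|x|^{−2Δ} with ℓ slowly varying and Δ ∈ [1/2, 1]
(scalingDimension_mem_Icc_holds); Δ > 1/2 is automatically screened, so the statement = (i) a
Gaussian limit of the n.n. model has Δ = 1/2 (Newman 1975: U₄ ≡ 0 ⇒ Gaussian in the Lee–Yang class;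
Markov inheritance + Pitt 1971 / Kotani 1973 Thm 2 / Rozanov: a scale-covariant germ-Markov Gaussian
field on ℝ³ is the massless free field — the half shared with GaussianLimitIsFree of route
AnomalousForcesInteraction) AND (ii) at Δ = 1/2 the slowly varying amplitude ℓ(r) = r·G(r·e) does
not tend to 0 ('a free limit is canonically normalised', Z ↛ 0). Only the case ℓ → 0 must be
excluded (not liminf ℓ = 0, which the strong form need -/
@[route_item "route-CriticalPhenomena-PerfectScreening", crux]
def GaussianLimitNotScreened : Prop :=
  ∀ (ρ : ℝ → ℝ) (Δ : ℝ) (S : Literature.Probability.LatticeModels.CorrFamily 3), (∀ δ ∈ Set.Ioc (0:ℝ) 1, 0 < ρ δ) → Literature.Probability.LatticeModels.HasPointwiseScalingLimit (Literature.Probability.LatticeModels.criticalCorr 3) ρ S → Literature.Probability.LatticeModels.IsNondegenerateTwoPoint S → Literature.Probability.LatticeModels.IsMoebiusCovariant Δ S → ¬ Literature.Probability.LatticeModels.HasNontrivialU4 S → ¬ Filter.Tendsto (fun x : Literature.Probability.LatticeModels.Site 3 => ‖x‖ * Literature.Probability.LatticeModels.criticalTwoPoint 3 x) Filter.cofinite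 (nhds 0)

/-- item stmt-CriticalPhenomena-1344 · crux · rank 5 · open · by planner
why it might fail: Existence of the full δ→0⁺ limit (one ρ, all n, locally uniform), O(3) invariance and inversion covariance are each open on ℤ³ (ICM 2022 §8.4 p.29; rotation invariance is a theorem only in d = 2, arXiv:2012.11672); scale ⇏ Möbius (ScaleCovarianceNotMoebius_holds); no uniqueness mechanism in d = 3.
sources: DuminilCopinICM2022 §8.1 p.25, §8.4 p.29, §9 p.30, PolandRychkovVichi2019 §II eq. (2), arXiv:2012.11672 (rotational invariance, planar only), Literature.Probability.LatticeModels.CritIsing3DEuclideanLimit (@[conjecture], crit-ising.S03, open), Literature.Barriers.CriticalPhenomena.ScaleCovarianceNotMoebius_holds, Literature.Barriers.CriticalPhenomena.LiouvilleRigidity_holds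
[crux] r5 = MoebLim (IMPORTED COMPLEMENT, lowest rank): the critical Ising correlators on ℤ³ have a
non-degenerate pointwise scaling limit (ρ > 0 on (0,1], Δ > 0, S) that is Möbius covariant with
dimension Δ — the conjunct Ising3DConformalLimit minus clause (iii). Written verbatim as the
conjunct's definiens without '∧ HasNontrivialU4 S' so that other routes filing the same complement
attach here. This route does not attack existence, rotation or inversion covariance; it bets on the
covariance lines (IsingEuclidUpgrade r5/r6 = items 0637/0638, IsingCFTData r2 = 0665, cards
hyperoctahedral-rp-rigidity / inversion-first-moebius-from-translations). S may be taken 0 off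
NonCoincident, so no coincident-configuration junk obstructs the existential. -/
@[route_item "route-CriticalPhenomena-PerfectScreening", crux]
def MoebiusLimitExists : Prop :=
  ∃ (ρ : ℝ → ℝ) (Δ : ℝ) (S : Literature.Probability.LatticeModels.CorrFamily 3), (∀ δ ∈ Set.Ioc (0:ℝ) 1, 0 < ρ δ) ∧ 0 < Δ ∧ Literature.Probability.LatticeModels.HasPointwiseScalingLimit (Literature.Probability.LatticeModels.criticalCorr 3) ρ S ∧ Literature.Probability.LatticeModels.IsNondegenerateTwoPoint S ∧ Literature.Probability.LatticeModels.IsMoebiusCovariant Δ S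

/-- item stmt-CriticalPhenomena-1342 · support · rank 3 · open · by planner
why it might fail: It is η(3) > 0 in liminf form — open: no gain over the FSS/MMS bound G ≤ C/|x| at β_c(3) is in print (DC–Panis 2025 improve only LOWER bounds; Thm 1.5: η ≤ 1/2 if it exists); its d ≥ 5 analogue is FALSE (c|x|^{2−d} ≤ G, DC–Panis Thm 1.4), so a proof must use d = 3; η ≈ 0.036 leaves no slack.
sources: FrohlichSimonSpencer1976, FrohlichIsraelLiebSimon1978, DuminilCopinPanis2025LowerBounds (arXiv:2404.05700 = doi:10.1007/s00220-025-05236-2; page-checked: Thm 1.3 axial lower bound, Thm 1.4 c|x|^{2-d} ≤ G for d ≥ 5 n.n. at β ≤ β_c up to L(β), Thm 1.5 d = 3: η ≤ 1/2 if it exists), AizenmanDuminilCopinAnnals2021 §5 (arXiv:1912.07973: regular scales, no upper-bound gain), Sakai2007 Thm 1.3 (G ~ A|x|^{2-d}, spread-out d > 4; tree Sakai2007_thm13_spreadOut), DuminilCopinICM2022 §4.2.1 p.12, §8.4 p.29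
[crux] r3 = NonSat: the Fröhlich–Simon–Spencer infrared bound G(x) ≤ C/|x| is NOT saturated at
β_c(3) along at least one sequence of axial scales: liminf_n n·⟨σ₀σ_{n e₁}⟩_{β_c} = 0 (∀ε>0,
frequently n·G(n e₁) < ε). This is η(3) > 0 in its weakest form (weaker than G = o(1/|x|), much
weaker than HasIsingEtaBounds with η > 0); under SubH the support item ScreeningUpgrade upgrades it
to the full limit ‖x‖G(x) → 0 (Z = 0, perfect screening), and ¬NonSat means the two-sided Coulomb
law c/|x| ≤ G ≤ C/|x| (ScreeningDichotomy). Dimension-specific: FALSE for d ≥ 5 (G ~ A|x|^{2−d},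
Sakai 2007). Engines foreseen (not filed, see rationale): the reductio 'Sat ⇒ pure Coulomb limit
point ⇒ Gaussian by the OS harmonic bootstrap, yet interacting by the top-heavy second moment'; or
an ε-gain over FSS at ONE scale, which the monotone flux propagates. -/
@[route_item "route-CriticalPhenomena-PerfectScreening", crux]
def NonSaturation : Prop :=
  ∀ ε : ℝ, 0 < ε → ∃ᶠ n : ℕ in Filter.atTop, (n : ℝ) * Literature.Probability.LatticeModels.criticalTwoPoint 3 (Pi.single 0 (n : ℤ)) < ε

/-- item stmt-CriticalPhenomena-1343 · support · rank 4 · open · by planner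
why it might fail: A generalised free field |x|^{-2Δ}, Δ>1/2, is Gaussian, RP, Möbius covariant: a proof must use the n.n. Markov structure (inheritance by the limit unproved) to force Δ=1/2 (Pitt/Kotani), then rule out G=ℓ(|x|)/|x|, ℓ→0 slowly varying — nothing known below d=5; false for long-range RP on ℤ³.
sources: Newman1975Gaussian, Pitt1971, Kotani1973 (Thm 2), Rozanov1982 (Ch. 3 §2.3: Markov iff spectral density 1/P), Nelson1973, Panis2023Triviality (arXiv:2309.05797 Thm 1.2, Cor 1.11)
[crux] r4 = GaussCoulomb: if (ρ, Δ, S) is a non-degenerate, Möbius-covariant pointwise scaling limit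
of the critical correlators on ℤ³ whose connected four-point function vanishes on all non-coincident
configurations (¬HasNontrivialU4 S), then the lattice two-point function obeys a Coulomb lower bound
G(x) ≥ c/‖x‖, c > 0, x ≠ 0 — 'a free limit of a finite-range reflection-positive model is mean-field
normalised (Z > 0)', as in d ≥ 5. Weaker than item 0636 (which forbids Gaussian limits outright);
exactly the weakening that perfect screening (‖x‖G → 0) contradicts, which is what makes SubH/NonSat
load-bearing in the assembly. Engine: U₄ ≡ 0 ⇒ Gaussian (Newman 1975, Lee–Yang class) ⇒ germ-Markov
limit for the n.n. specification (Markov inheritance, card anomalous-dimension-forces-interaction) ⇒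
Δ = 1/2 (Pitt 1971 / Kotani 1973: a scale-covariant Markov Gaussian field on ℝ³ is the massless free
field); remaining kernel: at Δ = 1/2, exclude a slowly varying screening factor ℓ(|x|) → 0 in G =
ℓ(|x|)/|x| (no known rigidity; in d ≥ 5 the lace expansion gives ℓ → A > 0). Hypotheses
IsNondegenerateTwoPoint/IsMoebiusCovariant are carried so that no killing-renormalisation or
coincident-confi -/
@[route_item "route-CriticalPhenomena-PerfectScreening", crux]
def GaussianLimitIsCoulomb : Prop :=
  ∀ (ρ : ℝ → ℝ) (Δ : ℝ) (S : Literature.Probability.LatticeModels.CorrFamily 3), (∀ δ ∈ Set.Ioc (0:ℝ) 1, 0 < ρ δ) → Literature.Probability.LatticeModels.HasPointwiseScalingLimit (Literature.Probability.LatticeModels.criticalCorr 3) ρ S → Literature.Probability.LatticeModels.IsNondegenerateTwoPoint S → Literature.Probability.LatticeModels.IsMoebiusCovariant Δ S → ¬ Literature.Probability.LatticeModels.HasNontrivialU4 S → ∃ c : ℝ, 0 < c ∧ ∀ x : Literature.Probability.LatticeModels.Site 3, x ≠ 0 → c / ‖x‖ ≤ Literature.Probability.LatticeModels.criticalTwoPoint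 3 x

/-- item stmt-CriticalPhenomena-1345 · support · rank 9 · closed · proved by Summit.CriticalPhenomena.Ising3DConformalLimit.Theorems.GreenAsymptotics_proof (prover) · by planner
sources: LawlerLimic2010 Thm 4.3.1, Lawler1991 Thm 1.5.4, Literature.Probability.LatticeModels.latticeGreen_asymptotics, Literature.Barriers.CriticalPhenomena.SpreadOutIsing.LiuSlade2026_nnGreenAsymptotics_holds
[support] Classical asymptotics of the Green function of the graph Laplacian of ℤ³: with G₀(x) :=
(2(2π)³)⁻¹ ∫_{[-π,π]³} cos(p·x)/Σ_i(1−cos p_i) dp (= latticeGreen x / 2 of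
Literature/Probability/LatticeModels/LatticeGreenFunction.lean, which is not in this route's import
cone; (−Δ_graph)G₀ = δ₀, G₀(0) ≈ 0.2527), there are a > 0 (in fact a = 1/4π) and K with |G₀(x) −
a/|x|₂| ≤ K/|x|₂² for x ≠ 0. Lawler–Limic 2010 Thm 4.3.1 / Lawler 1991 Thm 1.5.4 give the sharper
O(|x|⁻³); the same fact for general d is the (unproved) Literature named fact
Literature.Barriers.CriticalPhenomena.LiuSlade2026_nnGreenAsymptotics (d·latticeGreen =
a_d/⟦x⟧^{d−2} + O(⟦x⟧^{−d})), from which this item follows in a few lines once that fact is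
discharged. Antecedent of ScreeningUpgrade, ScreeningDichotomy and the Assembly. -/
@[route_item "route-CriticalPhenomena-PerfectScreening", crux]
def GreenAsymptotics : Prop :=
  ∃ a K : ℝ, 0 < a ∧ ∀ x : Literature.Probability.LatticeModels.Site 3, x ≠ 0 → |(∫ p in Set.pi Set.univ (fun _ : Fin 3 => Set.Icc (-Real.pi) Real.pi), Real.cos (∑ i, p i * (x i : ℝ)) / (∑ i, (1 - Real.cos (p i)))) / (2 * (2 * Real.pi) ^ 3) - a / Real.sqrt (∑ i, ((x i : ℝ)) ^ 2)| ≤ K / (∑ i, ((x i : ℝ)) ^ 2)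

-- `GreenAsymptotics` holds: proved by `Summit.CriticalPhenomena.Ising3DConformalLimit.Theorems.GreenAsymptotics_proof` (its module imports this route file, so no `_holds` link can be stated here).

/-- item stmt-CriticalPhenomena-1346 · support · rank 9 · closed · proved by Summit.CriticalPhenomena.Ising3DConformalLimit.Theorems.screeningUpgrade_proof (prover) · by planner
sources: LawlerLimic2010 §4.3, §6.1–6.2, MessagerMiracleSoleJSP1977, Literature.Probability.LatticeModels.twoPointPlus_le_axis_of_mem_sphere, Literature.Probability.LatticeModels.criticalTwoPoint_bounds_holds, Literature.Probability.LatticeModels.tendsto_latticeGreen_cofinite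
[support] The monotone-flux upgrade 'liminf ⇒ lim' (card (ii)–(iii)): GreenAsymptotics → SubH →
NonSat → ‖x‖·G(x) → 0 along the cofinite filter of ℤ³ (Z = 0, perfect screening). Proof sketch
(planner NOTES 'MATH'): μ := (−Δ)G ≤ 0 off 0, μ(0) = 6(1−G(e₁)) (lattice symmetries:
twoPointPlus_perm/reflection_invariant_holds); G₀ = latticeGreen/2 solves (−Δ)G₀ = δ₀ (Fourier
symbol 2ε(p); to be proved) and G₀ → 0 (tendsto_latticeGreen_cofinite); (1) for R ≥ 0, G −
G₀∗(μ1_{B_R}) is subharmonic and → 0 (G → 0 by criticalTwoPoint_bounds_holds), hence ≤ 0 by the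
maximum principle; (2) letting R → ∞ and using G ≥ 0: G = μ(0)G₀ − G₀∗ν with ν := −μ·1_{≠0} ≥ 0, the
difference being harmonic and → 0; (3) ν(ℤ³) ≤ μ(0) by summing G ≥ 0 over boxes and Σ_{B_R}G₀ ~ cR²
(GreenAsymptotics); Z := μ(0) − ν(ℤ³) ≥ 0; (4) by Messager–Miracle-Solé (messager_miracleSole_holds
+ symmetries) max_{‖x‖∞=n} G = G(n e₁), so NonSat makes the shell sums Σ_{S_{n_k}} G = o(n_k), while
the representation gives Σ_{S_n} G = Z·Σ_{S_n}G₀ − O(εn) − O(n·ν(|y|>εn)) with Σ_{S_n}G₀ ≍ n: hence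
Z = 0; (5) Z = 0 ⇒ ‖x‖G(x) ≤ 2aε·μ(0) + o(1) for every ε. Elementary given the antecedents; expected
1–3 kLoC. -/
@[route_item "route-CriticalPhenomena-PerfectScreening", crux]
def ScreeningUpgrade : Prop :=
  (∃ a K : ℝ, 0 < a ∧ ∀ x : Literature.Probability.LatticeModels.Site 3, x ≠ 0 → |(∫ p in Set.pi Set.univ (fun _ : Fin 3 => Set.Icc (-Real.pi) Real.pi), Real.cos (∑ i, p i * (x i : ℝ)) / (∑ i, (1 - Real.cos (p i)))) / (2 * (2 * Real.pi) ^ 3) - a / Real.sqrt (∑ i, ((x i : ℝ)) ^ 2)| ≤ K / (∑ i, ((x i : ℝ)) ^ 2)) → (∀ x : Literature.Probability.LatticeModels.Site 3, x ≠ 0 → 6 * Literature.Probability.LatticeModels.criticalTwoPoint 3 x ≤ ∑ i : Fin 3, (Literature.Probability.LatticeModels.criticalTwoPoint 3 (x + Pi.single i 1) + Literature.Probability.LatticeModels.criticalTwoPoint 3 (x - Pi.single i 1))) → (∀ ε : ℝ, 0 < ε → ∃ᶠ n : ℕ in Filter.atTop, (n : ℝ) * Literature.Probability.LatticeModels.criticalTwoPoint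 3 (Pi.single 0 (n : ℤ)) < ε) → Filter.Tendsto (fun x : Literature.Probability.LatticeModels.Site 3 => ‖x‖ * Literature.Probability.LatticeModels.criticalTwoPoint 3 x) Filter.cofinite (nhds 0)

-- `ScreeningUpgrade` holds: proved by `Summit.CriticalPhenomena.Ising3DConformalLimit.Theorems.screeningUpgrade_proof` (its module imports this route file, so no `_holds` link can be stated here).

/-- item stmt-CriticalPhenomena-1347 · support · rank 9 · closed · proved by Summit.CriticalPhenomena.Ising3DConformalLimit.Theorems.screeningInfraredBound_proof @ 00fcba88798a (prover) · by planner
sources: FrohlichSimonSpencer1976, Literature.Probability.LatticeModels.IsZdSubharmonicOn.nonpos_of_tendsto_zero, Literature.Probability.LatticeModels.criticalTwoPoint_bounds_holds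
[support, dividend] The x-space INFRARED BOUND WITH CONSTANT, free under SubH (card (i)): SubH →
G(x) ≤ 6(1 − G(e₁))·G₀(x) for every x (G₀ = graph-Laplacian Green function = latticeGreen/2, inline
integral), i.e. G ≤ μ(0)G₀ ≈ 4.02·G₀ at β_c(3); no Fourier/reflection-positivity argument. Proof: u
:= G − μ(0)G₀ has (−Δ)u = μ·1_{≠0} ≤ 0, u → 0 (criticalTwoPoint_bounds_holds,
tendsto_latticeGreen_cofinite), so u ≤ 0 by the maximum principle on ℤ³ (a subharmonic function
tending to 0 at infinity is ≤ 0). At x = 0 it predicts ⟨σ₀σ_{e₁}⟩_{β_c(3)} ≤ 1 − 1/(6G₀(0)) = 0.3405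
(measured ≈ 0.3302: nearly saturated) — itself a cheap numerical test of SubH. Needs the lattice
Poisson identity for latticeGreen (not yet in LatticeGreenFunction.lean). -/
@[route_item "route-CriticalPhenomena-PerfectScreening"]
def ScreeningInfraredBound : Prop :=
  (∀ x : Literature.Probability.LatticeModels.Site 3, x ≠ 0 → 6 * Literature.Probability.LatticeModels.criticalTwoPoint 3 x ≤ ∑ i : Fin 3, (Literature.Probability.LatticeModels.criticalTwoPoint 3 (x + Pi.single i 1) + Literature.Probability.LatticeModels.criticalTwoPoint 3 (x - Pi.single i 1))) → ∀ x : Literature.Probability.LatticeModels.Site 3, Literature.Probability.LatticeModels.criticalTwoPoint 3 x ≤ 6 * (1 - Literature.Probability.LatticeModels.criticalTwoPoint 3 (Pi.single 0 1)) * ((∫ p in Set.pi Set.univ (fun _ : Fin 3 => Set.Icc (-Real.pi) Real.pi), Real.cos (∑ i, p i * (x i : ℝ)) / (∑ i, (1 - Real.cos (p i)))) / (2 * (2 * Real.pi) ^ 3))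

-- `ScreeningInfraredBound` holds: proved by `Summit.CriticalPhenomena.Ising3DConformalLimit.Theorems.screeningInfraredBound_proof` @ 00fcba88798a (its module imports this route file, so no `_holds` link can be stated here).

/-- item stmt-CriticalPhenomena-1348 · support · rank 9 · closed · proved by Summit.CriticalPhenomena.Ising3DConformalLimit.Theorems.PerfectScreening.screeningDichotomy_proof (prover) · by planner
sources: MessagerMiracleSoleJSP1977, Hegerfeldt1977, Literature.Probability.LatticeModels.twoPointPlus_diagAxis_le_of_mem_sphere
[support, dividend] COULOMB OR SCREENED: GreenAsymptotics → SubH → (∃c>0, ∀x≠0, c/‖x‖ ≤ G(x)) ∨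
(‖x‖G(x) → 0). Proof from ScreeningUpgrade: if NonSat fails, n·G(n e₁) ≥ c₀ > 0 eventually, and
Messager–Miracle-Solé diagonal monotonicity (messager_miracleSole_diag_holds + symmetries: G(a,b,c)
≥ G((a+b+c)e₁) for a ≥ b ≥ c ≥ 0) gives G(x) ≥ G(‖x‖₁e₁) ≥ c₀/(3‖x‖∞) for large x, and G > 0
(criticalTwoPoint_bounds lower bound) handles the finitely many small x. Records the structural
content of SubH: with a monotone Gauss flux the critical two-point function is either two-sided
Coulomb (Z > 0, Δ = 1/2 forced) or perfectly screened (Z = 0) — no intermediate oscillation of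
|x|G(x) between 0 and a positive level. -/
@[route_item "route-CriticalPhenomena-PerfectScreening", crux]
def ScreeningDichotomy : Prop :=
  (∃ a K : ℝ, 0 < a ∧ ∀ x : Literature.Probability.LatticeModels.Site 3, x ≠ 0 → |(∫ p in Set.pi Set.univ (fun _ : Fin 3 => Set.Icc (-Real.pi) Real.pi), Real.cos (∑ i, p i * (x i : ℝ)) / (∑ i, (1 - Real.cos (p i)))) / (2 * (2 * Real.pi) ^ 3) - a / Real.sqrt (∑ i, ((x i : ℝ)) ^ 2)| ≤ K / (∑ i, ((x i : ℝ)) ^ 2)) → (∀ x : Literature.Probability.LatticeModels.Site 3, x ≠ 0 → 6 * Literature.Probability.LatticeModels.criticalTwoPoint 3 x ≤ ∑ i : Fin 3, (Literature.Probability.LatticeModels.criticalTwoPoint 3 (x + Pi.single i 1) + Literature.Probability.LatticeModels.criticalTwoPoint 3 (x - Pi.single i 1))) → ((∃ c : ℝ, 0 < c ∧ ∀ x : Literature.Probability.LatticeModels.Site 3, x ≠ 0 → c / ‖x‖ ≤ Literature.Probability.LatticeModels.criticalTwoPoint 3 x) ∨ Filter.Tendsto (fun x : Literature.Probability.LatticeModels.Site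 3 => ‖x‖ * Literature.Probability.LatticeModels.criticalTwoPoint 3 x) Filter.cofinite (nhds 0))

-- `ScreeningDichotomy` holds: proved by `Summit.CriticalPhenomena.Ising3DConformalLimit.Theorems.PerfectScreening.screeningDichotomy_proof` (its module imports this route file, so no `_holds` link can be stated here).

/-- item stmt-CriticalPhenomena-13887 · support · rank 9 · open · by planner
sources: item stmt-CriticalPhenomena-1341 evidence SubH_review3_analysis.md (refuter bc059723), DuminilcopinPanis2025 (arXiv:2404.05700 Thm 1.5: η ≤ 1/2 if it exists)
[support] PRE-FILED REPAIR of r2: ∃ R, ΔG(x) ≥ 0 for ‖x‖ > R — the screening cloud carries only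
finitely many positive charges. Implied by SubharmonicOffOrigin (R := 0; Sketch lemma
eventuallySubharmonic_of_subharmonicOffOrigin). Robust exactly where SubH is fragile: asymptotically
ΔG ≈ A[η(1+η)r^{−3−η} + B(1+η+ω)(η+ω)r^{−3−η−ω}] is positive for r > R₀(B) ≈ (43|B|)^{1.2} for
EITHER sign of the leading correction amplitude B (η ≈ 0.036, ω ≈ 0.83), whereas SubH at |x| ≤ 40
hangs on sign B and on non-universal short-distance values (refuter notes 80a57a10 / bc059723 on
item 1341). With GreenAsymptotics it yields the same dichotomy (ScreeningDichotomyEventual) and the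
deciding theorem re-certifies with (EventuallySubharmonic, ScreeningDichotomyEventual) in place of
(SubharmonicOffOrigin, ScreeningDichotomy) — planner folder Sketch.lean `closes3`, rc 0. NOT a crux
(staffing stays on r2; a proof of r2 proves it); anyone idle may prove or attack it. Kill: worm-MC
violations of D(x) ≥ 0 that persist or GROW relative to 0.0093/|x|³ for |x| ∈ [20, 40]. [difficulty:
open-problem] -/
@[route_item "route-CriticalPhenomena-PerfectScreening", crux]
def EventuallySubharmonic : Prop :=
  ∃ R : ℝ, ∀ x : Literature.Probability.LatticeModels.Site 3, R < ‖x‖ → 6 * Literature.Probability.LatticeModels.criticalTwoPoint 3 x ≤ ∑ i : Fin 3, (Literature.Probability.LatticeModels.criticalTwoPoint 3 (x + Pi.single i 1) + Literature.Probability.LatticeModels.criticalTwoPoint 3 (x - Pi.single i 1))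

/-- item stmt-CriticalPhenomena-13888 · support · rank 9 · closed · proved by Summit.CriticalPhenomena.Ising3DConformalLimit.Theorems.PerfectScreening.screeningDichotomyEventual_proof (prover) · by planner
sources: LawlerLimic2010 §4.3, §6.1–6.2, MessagerMiracleSoleJSP1977, Literature.Probability.LatticeModels.IsZdSubharmonicOn.nonpos_of_tendsto_zero, Literature.Probability.LatticeModels.twoPointPlus_diagAxis_le_of_mem_sphere
[support] GreenAsymptotics → EventuallySubharmonic → (∃c>0, ∀x≠0, c/‖x‖ ≤ G) ∨ (‖x‖G → 0): the
screening dichotomy with a finite exceptional set (pre-filed glue for the repair of r2). Proof =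
that of ScreeningDichotomy (item 1348) with the finitely supported signed charge μ₀ := (−ΔG)·1_{B_R}
in place of the point charge: (1) for R' ≥ R, u := G − G₀∗(μ1_{B_{R'}}) has (−Δ)u = μ1_{B_{R'}^c} ≤
0 and u → 0, so u ≤ 0 by the maximum principle at infinity
(IsZdSubharmonicOn.nonpos_of_tendsto_zero, criticalTwoPoint_bounds_holds,
tendsto_latticeGreen_cofinite); (2) box sums Σ_{Λ_L}G ≥ 0 with Σ_{Λ_L}G₀(·−y) ∼ S_L ≍ L² give
ν(B_{R'}∖B_R) ≤ μ₀(ℤ³) =: M₀ for ν := (ΔG)1_{B_R^c} ≥ 0, so ν is finite and Z := M₀ − ν(ℤ³) ≥ 0; (3)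
G = G₀∗(μ₀ − ν) exactly (the difference is bounded, harmonic and → 0); (4) shell averages
(1/n)Σ_{‖x‖∞=n}G → c₀Z with c₀ from GreenAsymptotics; Z > 0 ⇒ Coulomb lower bound by
Messager–Miracle-Solé (maximum on the ℓ∞-shell attained on the axis, G(a,b,c) ≥ G((a+b+c)e₁):
twoPointPlus_le_axis_of_mem_sphere, twoPointPlus_diagAxis_le_of_mem_sphere) and positivity at small
x; Z = 0 ⇒ G ≤ G₀∗μ₀ − G₀∗(ν1_{B_{ε|x|}}) (drop a nonnegative part), hence ‖x‖G(x) ≤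
‖x‖G₀(x)ν(B^c_{ε|x|}) + O -/
@[route_item "route-CriticalPhenomena-PerfectScreening"]
def ScreeningDichotomyEventual : Prop :=
  (∃ a K : ℝ, 0 < a ∧ ∀ x : Literature.Probability.LatticeModels.Site 3, x ≠ 0 → |(∫ p in Set.pi Set.univ (fun _ : Fin 3 => Set.Icc (-Real.pi) Real.pi), Real.cos (∑ i, p i * (x i : ℝ)) / (∑ i, (1 - Real.cos (p i)))) / (2 * (2 * Real.pi) ^ 3) - a / Real.sqrt (∑ i, ((x i : ℝ)) ^ 2)| ≤ K / (∑ i, ((x i : ℝ)) ^ 2)) → (∃ R : ℝ, ∀ x : Literature.Probability.LatticeModels.Site 3, R < ‖x‖ → 6 * Literature.Probability.LatticeModels.criticalTwoPoint 3 x ≤ ∑ i : Fin 3, (Literature.Probability.LatticeModels.criticalTwoPoint 3 (x + Pi.single i 1) + Literature.Probability.LatticeModels.criticalTwoPoint 3 (x - Pi.single i 1))) → ((∃ c : ℝ, 0 < c ∧ ∀ x : Literature.Probability.LatticeModels.Site 3, x ≠ 0 → c / ‖x‖ ≤ Literature.Probability.LatticeModels.criticalTwoPoint 3 x) ∨ Filter.Tendsto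 (fun x : Literature.Probability.LatticeModels.Site 3 => ‖x‖ * Literature.Probability.LatticeModels.criticalTwoPoint 3 x) Filter.cofinite (nhds 0))

-- `ScreeningDichotomyEventual` holds: proved by `Summit.CriticalPhenomena.Ising3DConformalLimit.Theorems.PerfectScreening.screeningDichotomyEventual_proof` (its module imports this route file, so no `_holds` link can be stated here).

/-- item stmt-CriticalPhenomena-13893 · support · rank 9 · closed · proved by Summit.CriticalPhenomena.Ising3DConformalLimit.Theorems.mixedSpectralRepresentation_proof (prover) · by planner
sources: AizenmanDuminilCopinAnnals2021 (arXiv:1912.07973 Prop. 5.3 p. 17; App. Prop. 8.6 pp. 32–33), GlimmJaffe1987 (§6.1 Remark 'Transfer matrix of statistical physics', pp. 89–90), BergChristensenRessel1984 (Ch. 4 Thm. 2.8 p. 96; Ch. 3 Thm. 2.2 p. 75; Ch. 4 Prop. 3.15 p. 105), SchultzMattisLieb1964 (doi:10.1103/RevModPhys.36.856), Onsager1944, Literature.Probability.LatticeModels.axisForm_sq_le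
[support] FIRST LEMMA of the r2 attack (reflection-positivity spectral calculus); a KNOWN result,
typed in the quadratic-form version that needs no Bochner theorem: for every finitely supported real
v on the plane ℤ² (support s), the axial form Q_v(n) := Σ_{x,y∈s} v_x v_y G((n, x−y)) is a Hausdorff
moment sequence on [0,1]: Q_v(n) = ∫ λ^{|n|} dμ_v, μ_v ≥ 0 finite (ADC 2021 Prop. 5.3 / App. Prop.
A.6 = arXiv Prop. 8.6, valid for all β incl. β_c, via the transfer matrix of the tubes 𝕋(m,ℓ) and
the moment criterion as ℓ → ∞; Glimm–Jaffe 1987 §6.1 pp. 89–90: bond RP gives the transfer operator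
0 ≤ K ≤ I and unitary transverse translations; λ ≥ 0 = positivity of the transfer matrix, in tree
for tori: TorusTransferSpectral; real v suffices since G(n,·) is even). By polarisation + Bochner in
x⊥ (BCR84 Ch. 4 Thm. 2.8 p. 96: bounded positive-definite functions on the *-semigroup ℕ×ℤ² are
unique mixtures of the characters λⁿe^{ik·x}) it is the joint spectral measure ρ ≥ 0 on [0,1]×𝕋²
with G(n,x⊥) = ∫ λ^{|n|}cos(k·x⊥) dρ, total mass G(0) = 1, in which the lattice Laplacian becomes a
SIGNED WEIGHT: ΔG(n,x⊥) = ∫ λ^{n−1}[(1−λ)² − λk̂²] e^{ik·x⊥} dρ for n ≥ 1, k̂² = Σ_j 2(1−cos k_j) (λ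
< 0, allow -/
@[route_item "route-CriticalPhenomena-PerfectScreening"]
def MixedSpectralRepresentation : Prop :=
  ∀ (s : Finset (Fin 2 → ℤ)) (v : (Fin 2 → ℤ) → ℝ), ∃ μ : MeasureTheory.Measure ℝ, MeasureTheory.IsFiniteMeasure μ ∧ μ (Set.Icc (0:ℝ) 1)ᶜ = 0 ∧ ∀ n : ℤ, ∑ x ∈ s, ∑ y ∈ s, v x * v y * Literature.Probability.LatticeModels.criticalTwoPoint 3 (Fin.cons n (x - y)) = ∫ t, t ^ n.natAbs ∂μ

-- `MixedSpectralRepresentation` holds: proved by `Summit.CriticalPhenomena.Ising3DConformalLimit.Theorems.mixedSpectralRepresentation_proof` (its module imports this route file, so no `_holds` link can be stated here).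

/-- item stmt-CriticalPhenomena-1349 · assembly · rank 1 · closed · proved by Summit.CriticalPhenomena.Ising3DConformalLimit.Theorems.assembly_proof @ 7344b488c6d3 (prover) · by planner
sources: idea card Summits/CriticalPhenomena/Ising3DConformalLimit/Ideas/perfect-screening-subharmonic.md
[assembly] SubH → NonSat → GreenAsymptotics → ScreeningUpgrade → GaussCoulomb → MoebLim →
Ising3DConformalLimit. Glue (verified, planner Sketch.lean `assembly_glue`, 15 lines): take (ρ,Δ,S)
from MoebLim; by_contra on HasNontrivialU4 S; GaussCoulomb gives c > 0 with c/‖x‖ ≤ G(x) for x ≠ 0;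
ScreeningUpgrade (fed GreenAsymptotics, SubH, NonSat) gives ‖x‖G(x) → 0 cofinitely, so eventually
‖x‖G(x) < c at some x ≠ 0 (Filter.eventually_cofinite_ne), contradicting c ≤ ‖x‖G(x) (div_le_iff₀,
norm_pos_iff). Then ⟨ρ,Δ,S,…,hU4⟩ is the conjunct (root abbrev Ising3DConformalLimit =
Literature.Probability.LatticeModels.CritIsing3DConformalLimit). -/
@[route_item "route-CriticalPhenomena-PerfectScreening"]
def Assembly : Prop :=
  (∀ x : Literature.Probability.LatticeModels.Site 3, x ≠ 0 → 6 * Literature.Probability.LatticeModels.criticalTwoPoint 3 x ≤ ∑ i : Fin 3, (Literature.Probability.LatticeModels.criticalTwoPoint 3 (x + Pi.single i 1) + Literature.Probability.LatticeModels.criticalTwoPoint 3 (x - Pi.single i 1))) → (∀ ε : ℝ, 0 < ε → ∃ᶠ n : ℕ in Filter.atTop, (n : ℝ) * Literature.Probability.LatticeModels.criticalTwoPoint 3 (Pi.single 0 (n : ℤ)) < ε) → (∃ a K : ℝ, 0 < a ∧ ∀ x : Literature.Probability.LatticeModels.Site 3, x ≠ 0 → |(∫ p in Set.pi Set.univ (fun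 _ : Fin 3 => Set.Icc (-Real.pi) Real.pi), Real.cos (∑ i, p i * (x i : ℝ)) / (∑ i, (1 - Real.cos (p i)))) / (2 * (2 * Real.pi) ^ 3) - a / Real.sqrt (∑ i, ((x i : ℝ)) ^ 2)| ≤ K / (∑ i, ((x i : ℝ)) ^ 2)) → ((∃ a K : ℝ, 0 < a ∧ ∀ x : Literature.Probability.LatticeModels.Site 3, x ≠ 0 → |(∫ p in Set.pi Set.univ (fun _ : Fin 3 => Set.Icc (-Real.pi) Real.pi), Real.cos (∑ i, p i * (x i : ℝ)) / (∑ i, (1 - Real.cos (p i)))) / (2 * (2 * Real.pi) ^ 3) - a / Real.sqrt (∑ i, ((x i : ℝ)) ^ 2)| ≤ K / (∑ i, ((x i : ℝ)) ^ 2)) → (∀ x : Literature.Probability.LatticeModels.Site 3, x ≠ 0 → 6 * Literature.Probability.LatticeModels.criticalTwoPoint 3 x ≤ ∑ i : Fin 3, (Literature.Probability.LatticeModels.criticalTwoPoint 3 (x + Pi.single i 1) + Literature.Probability.LatticeModels.criticalTwoPoint 3 (x - Pi.single i 1))) → (∀ ε : ℝ, 0 < ε → ∃ᶠ n : ℕ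 in Filter.atTop, (n : ℝ) * Literature.Probability.LatticeModels.criticalTwoPoint 3 (Pi.single 0 (n : ℤ)) < ε) → Filter.Tendsto (fun x : Literature.Probability.LatticeModels.Site 3 => ‖x‖ * Literature.Probability.LatticeModels.criticalTwoPoint 3 x) Filter.cofinite (nhds 0)) → (∀ (ρ : ℝ → ℝ) (Δ : ℝ) (S : Literature.Probability.LatticeModels.CorrFamily 3), (∀ δ ∈ Set.Ioc (0:ℝ) 1, 0 < ρ δ) → Literature.Probability.LatticeModels.HasPointwiseScalingLimit (Literature.Probability.LatticeModels.criticalCorr 3) ρ S → Literature.Probability.LatticeModels.IsNondegenerateTwoPoint S → Literature.Probability.LatticeModels.IsMoebiusCovariant Δ S → ¬ Literature.Probability.LatticeModels.HasNontrivialU4 S → ∃ c : ℝ, 0 < c ∧ ∀ x : Literature.Probability.LatticeModels.Site 3, x ≠ 0 → c / ‖x‖ ≤ Literature.Probability.LatticeModels.criticalTwoPoint 3 x) → (∃ (ρ : ℝ → ℝ) (Δ : ℝ) (S : Literature.Probability.LatticeModels.CorrFamily 3), (∀ δ ∈ Set.Ioc (0:ℝ) 1, 0 < ρ δ) ∧ 0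 < Δ ∧ Literature.Probability.LatticeModels.HasPointwiseScalingLimit (Literature.Probability.LatticeModels.criticalCorr 3) ρ S ∧ Literature.Probability.LatticeModels.IsNondegenerateTwoPoint S ∧ Literature.Probability.LatticeModels.IsMoebiusCovariant Δ S) → Ising3DConformalLimit

-- `Assembly` holds: proved by `Summit.CriticalPhenomena.Ising3DConformalLimit.Theorems.assembly_proof` @ 7344b488c6d3 (its module imports this route file, so no `_holds` link can be stated here).

/-! D-0027 §2.1 — DECIDING THEOREM (planner-authored via `route open/edit --closes-file`; by planner-promote-CriticalPhenomena-PerfectScree-ec56537f-0 2026-08-15T22:47:01Z):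
its hypotheses are this route's items and its conclusion the sub-problem Statement (glue_lint), and it elaborates with this file. -/

@[closes "route-CriticalPhenomena-PerfectScreening"] theorem closes
    (h_SubharmonicOffOrigin : SubharmonicOffOrigin)
    (h_CoulombImpliesNontrivial : CoulombImpliesNontrivial)
    (h_GaussianLimitNotScreened : GaussianLimitNotScreened)
    (h_MoebiusLimitExists : MoebiusLimitExists)
    (h_GreenAsymptotics : GreenAsymptotics)
    (h_ScreeningDichotomy : ScreeningDichotomy) :
    _root_.Ising3DConformalLimit := by
  -- the Möbius-covariant non-degenerate limit (ρ, Δ, S) supplied by the imported complement (r5)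
  obtain ⟨ρ, Δ, S, hρ, hΔ, hlim, hnd, hM⟩ := h_MoebiusLimitExists
  refine ⟨ρ, Δ, S, hρ, hΔ, hlim, hnd, hM, ?_⟩
  -- clause (iii) by contradiction: suppose U₄ ≡ 0 on non-coincident configurations
  by_contra hU4
  -- SubH (r2) + the ℤ³ Green asymptotics give the SCREENING DICHOTOMY: Coulomb lower bound, or ‖x‖·G(x) → 0
  rcases h_ScreeningDichotomy h_GreenAsymptotics h_SubharmonicOffOrigin with hCoulomb | hScreened
  · -- Coulomb branch: two-sided 1/‖x‖ law ⇒ intersecting currents ⇒ U₄ ≢ 0 (r3)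
    exact hU4 (h_CoulombImpliesNontrivial hCoulomb ρ S hρ hlim hnd)
  · -- screened branch: a Gaussian Möbius limit is never perfectly screened (r4)
    exact h_GaussianLimitNotScreened ρ Δ S hρ hlim hnd hM hU4 hScreened

end Summit.CriticalPhenomena.Ising3DConformalLimit.Theses.PerfectScreening
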